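import Mathlib
import HarnessLib
import HarnessLib.Audit
import Summits.CriticalPhenomena.Statement
import Literature.Probability.Percolation.CardyFormula
import Literature.Probability.Percolation.TipBalanceSum
import HarnessLib.Audit.Status.Attr

/-!
Route: CardyObliqueExplorer

DORMANT since 2026-08-24T00:04:13Z (reconciler: no traction for 6.4 d (last activity item-evidence-added at 2026-08-17T14:50:25Z); parked, not closed — `ledger route dormant route-CriticalPhenomena-CardyObliqueExplorer --off` to reactiv) — unstaffed, not closed; items shared with open routes are served there. `ledger route dormant <id> --off` reactivates.

# Route CardyObliqueExplorer — Oblique harmonic explorer — Cardy on Z2 as a fair-coin vs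
oblique-coin tip balance for the exploration hitting event

It suffices to show X = ExplorationHitCardy: for every conformal rectangle R = (Ω; a, b, c, d) and
every admissible square-lattice
discretising family E of its chord (Ω; a, c) (canonical domain Ω_δ, mesh δ, wired arc → (abc) and
dual-wired arc → (cda) in Hausdorff
distance, discrete marks → {a, c}, IsZdAdmissible for all small δ), the P_{1/2}-probability that the
a→c-oriented medial exploration of
critical bond percolation in E δ examines an edge with an endpoint on the discrete arc of (cd)
before any edge with an endpoint on the
discrete arc of (bc) tends to F(η) (Cardy–Carleson) as δ → 0⁺, η the cross-ratio of any uniformizing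
datum. Card realised:
oblique-harmonic-explorer-2. The mechanism attacks X through an auxiliary OBLIQUELY REDIRECTED /
KILLED random walk on the unrevealed
medial cells whose absorption probability u_n at the corner b is Cardy's SLE₆ martingale observable
discretised LINEARLY: the Doob
(rank-one) update of u_n when the exploration reveals one cell gives the exact identity P[hit (cd)
first] − u₀(c_δ) = ½·E Σ_n w_n(c_δ)(c_n −
2u_n)(f_n) (DoobIdentity), so X ⇐ ObliqueInvariance (u₀^δ(c_δ) → F(η): oblique walk → ORBM(π/3),
fixed domain) ∧ TipBalance (the stencil
sum → 0). Those two cruxes, KernelDominance and DoobIdentity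
(stmt-CriticalPhenomena-7451/7456/7448/7457) are typed over the LANDED definitions D1
`Literature.Probability.LatticeModels.obliqueMedialAbsorb` / D2
`Literature.Probability.Percolation.tipBalanceSum` (signatures set by
set-signature right after this revision, same (R, E) hypothesis block as X); the typed frame is X →
CardyFormulaZ2 through the crossing / discrete-hitting
dictionary (CrossingHitDictionary) and the non-vacuity support DiscretisationExists. REPAIR rev 1
(2026-08-15): the canonical-data guard
and the continuum event CurveClass.hitsBefore of the rev-0 frame (ExplorationCardy 6205,
InterfaceDictionary 0754, AdmissibleSuffices 0756,
Assembly 6207) were vacuous-or-degenerate (refuter rreview-7b9376c7;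
CanonicalDiscretisationTies.lean) and are dropped from this route.
Lean: `∀ (R : Literature.Probability.RandomPlanarGeometry.ConformalRectangle) (E : ℝ →
Literature.Probability.LatticeModels.DiscreteDobrushin), (∀ δ, (E δ).Ω = R.carrier ∧ (E δ).δ = δ) →
Filter.Tendsto (fun δ => Metric.hausdorffEDist (E δ).arcA ((R.chord 0 2 (by decide)).arc 0))
(nhdsWithin 0 (Set.Ioi 0)) (nhds 0) → Filter.Tendsto (fun δ => Metric.hausdorffEDist (E δ).arcB
((R.chord 0 2 (by decide)).arc 1)) (nhdsWithin 0 (Set.Ioi 0)) (nhds 0) → Filter.Tendsto (fun δ =>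
Metric.hausdorffEDist (Literature.Probability.LatticeModels.medialPoint δ '' (E δ).zdABEdges) {R.pt
0, R.pt 2}) (nhdsWithin 0 (Set.Ioi 0)) (nhds 0) → (∀ᶠ δ in nhdsWithin (0:ℝ) (Set.Ioi 0), (E
δ).IsZdAdmissible) → R.HasCrossingLimit (fun δ =>
(Literature.Probability.Percolation.bondPercolation (Literature.Probability.LatticeModels.zdGraph 2)
Literature.Probability.Percolation.half).real {cfg | let l :=
Literature.Probability.LatticeModels.medialExploration (E δ) cfg; let l' := (if (∀ e₀ ∈ l.head?,
dist (Literature.Probability.LatticeModels.medialPoint δ e₀) (R.pt 0) ≤ dist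
(Literature.Probability.LatticeModels.medialPoint δ e₀) (R.pt 2)) then l else l.reverse); ∃ n : ℕ, ∃
e ∈ l'[n]?, (∃ v ∈ e, v ∈ (E δ).zdDiscreteArc (R.arc 2)) ∧ ∀ m < n, ∀ e' ∈ l'[m]?, ∀ v ∈ e', v ∉ (E
δ).zdDiscreteArc (R.arc 1)}) Literature.Probability.RandomPlanarGeometry.cardyFunction`

## Assembly
Deciding theorem (glue.lean, certified): closes (hD : DiscretisationExists) (hX :
ExplorationHitCardy) (hC : CrossingHitDictionary) :
CardyFormulaZ2 — for every R pick E from DiscretisationExists; ExplorationHitCardy gives P[hit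
(cd)_δ first] → F(η) for every uniformizing
datum and CrossingHitDictionary gives bondDomainCrossingProb R δ − P[hit] → 0, so
bondDomainCrossingProb R → F(η): pure filter algebra
(Tendsto.add, sub_add_cancel), no admissibility guard, no Assembly item (the rev-0 Assembly 6207 is
dropped). The mechanism's own layer
(DoobIdentity → ObliqueInvariance → TipBalance → ExplorationHitCardy) is the foreseen glued split of
X once the walk is defined.

Rationale: WHY THIS LINE. Smirnov's proof needs an exactly harmonic observable of percolation, which ℤ² refuses
(barriers SmirnovTriangularOnly,
FKParafermionicHalfCauchyRiemann); the harmonic explorer (SchrammSheffield2005, arXiv:math/0310210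
§3) instead BUILDS the observable into an
auxiliary random walk and gets an exact martingale by the Doob factorisation "revealing one cell
changes the hitting probability by a
rank-one update through P_z[reach that cell]". The card's observation is that this factorisation
survives an OBLIQUE (redirecting) boundary
type, and that Cardy's SLE₆ observable is exactly a mixed Dirichlet/oblique harmonic function — the
gambler's-ruin height of Brownian motion
obliquely reflected at angle π/3 (LawlerSchrammWerner2001, Werner2007 §3/§5, Dubedat2004 =
math/0302250) — so on the medial lattice of ℤ² one
gets (i) an oblique harmonic explorer whose Cardy observable is an exact martingale (companion, not
load-bearing) and (ii) for percolation
(fair coin) an exact identity expressing the deviation from Cardy as a non-negatively weighted local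
stencil sum at the tip. Imported areas:
potential theory of obliquely reflected diffusions and their random-walk approximations
(VaradhanWilliams1985, KangWilliams2007 =
arXiv:0704.0405) for ObliqueInvariance; the SLE₆/ORBM dictionary for the value; discrete
martingale-observable technology
(SchrammSheffield2005) for the companion. Unlike CardyHarmonicInvariants/CardyDiscreteHolo no
holomorphic or three-armed observable of
percolation is sought; unlike CardyViaSLE6/CardyRotToConf/CardyUniqueLimit no symmetry of
subsequential limits is upgraded; unlike the retired
sibling card kakutani-fingerprint-discrete-ito the residual is a specific linear statistic with
explicit weights, it comes with an
independent theorem-sized crux (ObliqueInvariance) and a solvable control process. The typed frame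
is stated over ALL admissible
discretising families (CDHKS-style, as SLE6LimitZ2AllDiscretisations) and the LATTICE hitting event,
so it is neither guarded into vacuity
by zdDiscreteArc ties of the canonical data nor tied to a continuum event the polyline cannot
realise.

RANKED CRUXES. Ranked list (informal items keep their ledger ids; typed items are the blocks below).
#2 TipBalance (informal crux,
stmt-CriticalPhenomena-7451): tipBalanceSum R E δ := E_{1/2}[Σ_{n<T} w_n(c_δ)(c_n(f_n) − 2u_n(f_n))]
→ 0 along the exploration of E δ stopped at
the first step adjacent to the discrete arcs of (bc) ∪ (cd) — why it might fail: given
ObliqueInvariance + DoobIdentity it is EQUIVALENT to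
ExplorationHitCardy, and as a handle it dies if the tip stencil keeps a non-decaying per-step bias
(the kakutani-fingerprint verdict) or
Σ_n w_n(c_δ) outgrows the stencil decay [SchrammSheffield2005, arXiv:1112.2017, Smirnov2001]. #3
ObliqueInvariance (informal crux, 7456): in
the FIXED discrete domain the absorption probability of the oblique medial walk started at the
(cd)-cell nearest c converges to
cardyFunction(η) — why it might fail: a slope-blind local redirection rule has a slope-dependent
effective reflection angle on lattice
staircases (wrong oblique limit in non-rectilinear domains); Jordan boundaries need a comparison
principle for the mixed problem
[Dubedat2004, VaradhanWilliams1985, KangWilliams2007, Werner2007]. #4 ExplorationHitCardy (typed,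
below). #5 CrossingHitDictionary (typed,
below). #6 KernelDominance (informal crux, 7448): c_n(f_n) ≥ u_n(f_n) for the filed kernel in every
reachable slit domain — why it might
fail: redirecting toward b can LOWER the absorption probability when r(f) sits nearer the killing
bank (left bank doubling back)
[SchrammSheffield2005, Dubedat2004]. Supports: DoobIdentity (informal, 7457; provable once D1/D2
land), CarlesonAtOpenCorner, DiscretisationExists.
D1/D2 LANDED (ObliqueMedialAbsorb.lean 14:48Z, TipBalanceSum.lean 15:11Z): the signatures of
7451/7456/7448/7457 are set (workitem
set-signature, this revision) over (R, E) with the hypothesis block HB of ExplorationHitCardy (NOT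
the retired canonical guard /
CurveClass.hitsBefore of their informal texts): TipBalance `HB → Tendsto (fun δ => tipBalanceSum R
(E δ)) (𝓝[>] 0) (𝓝 0)`; ObliqueInvariance
`HB → R.HasCrossingLimit (fun δ => obliqueMedialAbsorb R (E δ) ∅ [] (obliqueMedialCCell R (E δ)))
cardyFunction`; DoobIdentity typed in the
o(1) form the layer-2 glue needs, `HB → Tendsto (fun δ => P.real{hit} − u₀ − tipBalanceSum R (E
δ)/2) (𝓝[>] 0) (𝓝 0)` (the EXACT identity at
each admissible δ is the prover's route to it and stays the card's claim; three conventions of the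
landed kernel make literal exactness
fragile and are the first things a grounder/refuter should test by computation: arcRedirect
re-filters interior neighbours once a cell is
revealed (rank-one update only approximately), exhausted resolution fuel on redirect cycles leaks
mass to ⊥, and the deciding cell γ[T] is
left unrevealed so the endpoint clause u_T(c_δ) = 1_{hit} holds only up to the leak through that one
boundary cell); KernelDominance typed
division-free as the two-point monotonicity `u_n(f_n) ≤ β·u_n(r₁) + (1 − β)·u_n(r₂)` over the tip
law pathRedirect (fresh steps 0 < n < T,
cells not within 2δ of b), which is c_n(f_n) ≥ u_n(f_n) off the junk case w̄ = 1. All four elaborate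
and the layer-2 glue DoobIdentity →
ObliqueInvariance → TipBalance → ExplorationHitCardy is checked sorry-free in the planner sketch
(Sketch3.lean).
#4 ExplorationHitCardy (crux) — X itself, typed (the node that TipBalance (2), ObliqueInvariance
(3), KernelDominance (6) and DoobIdentity decompose once D1/D2 land): for every conformal rectangle
R and every admissible discretising family E of its chord (Ω; a, c) (fields of
ZdDiscretisationFamily / IsDiscretisation inlined: (E δ).Ω = Ω, mesh δ, arcs → (abc), (cda) in
Hausdorff distance, discrete marks → {a, c}, IsZdAdmissible eventually), the P_{1/2}-probability
that the a→c-oriented medial exploration of E δ examines an edge with an endpoint on zdDiscreteArc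
(R.arc 2) = (cd)_δ before any edge with an endpoint on zdDiscreteArc (R.arc 1) = (bc)_δ has crossing
limit cardyFunction (→ F(η) for every uniformizing datum). Same event, verbatim, as in
CrossingHitDictionary; replaces ExplorationCardy (6205). [deps: CrossingHitDictionary,
DiscretisationExists] [difficulty: open-problem] (why it might fail: it IS Cardy's value for the
lattice hitting event: false iff CardyFormulaZ2 fails modulo CrossingHitDictionary (Zhang
arXiv:2206.04599 Cor. 2 claims failure on Z2, contested by arXiv:2409.03235); an admissible E with
fragmented discrete arcs near c could bias the a.s.-defined hit order.) [Smirnov2001, Werner2007,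
SchrammSheffield2005, arXiv:2206.04599, arXiv:2409.03235, Smirnov2007ICM]
#5 CrossingHitDictionary (crux) — crossing / discrete-hitting dictionary on ℤ²
(stmt-CriticalPhenomena-7364, unchanged): for every conformal rectangle R and every admissible
discretising family E of its chord (Ω; a, c), the free-boundary crossing probability P_{1/2}[(ab)_δ
↔ (cd)_δ in Ω_δ] (bondDomainCrossingProb R δ) and the probability that the a→c-oriented medial
exploration of E δ examines an edge with an endpoint on the discrete arc of (cd) before any edge
with an endpoint on the discrete arc of (bc) differ by o(1) as δ → 0⁺ (boundary-condition
insensitivity near the four marks: RSW + half-plane 3-arm estimates). [difficulty: M] (why it might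
fail: needs half-plane 3-arm / RSW decoupling on Z2 near the marks for G02's largest-component
discretisation with (abc) wired; a wild Jordan arc near b or d (empty or fragmented zdDiscreteArc of
(bc)/(cd)) breaks the o(1); tie sites near c must carry vanishing mass.) [Werner2007, Smirnov2001,
CamiaNewman2007, AizenmanBurchard1999, Grimmett1999]
#9 CarlesonAtOpenCorner (support) — Carleson's identity at the corner where the oblique observable
lives (stmt-CriticalPhenomena-6206, unchanged): if R = (Ω; a, b, c, d) has carrier the open
equilateral triangle on a, b, d and its third mark c lies on the open side (b, d), then for every
uniformizing datum cardyFunction(η) = |c − d| / |b − d|. Provable now from the proved fact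
cardyFunction_crossRatio_eq_of_equilateral_holds applied to the rotated marking (d, a, b, c), η ↦ 1
− η, F(1 − η) = 1 − F(η). [difficulty: provable-now] [Werner2007, Smirnov2001, BollobasRiordan2006]
#9 DiscretisationExists (support) — non-vacuity of the typed frame (stmt-CriticalPhenomena-7379,
unchanged): every chord (Ω; a, c) of a conformal rectangle admits an admissible square-lattice
discretising family E : ℝ → DiscreteDobrushin (the six fields of ZdDiscretisationFamily, inlined).
Expected witness: perturb the two continuum arcs by ≍ δ so that no zdBoundary site ties and exactly
one A–B edge sits at each mark, each bordering exactly one inner face (module doc of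
InterfaceScalingLimitDiscretised.lean). [difficulty: M] [Smirnov2007ICM, CamiaNewman2007,
ChelkakSmirnov2012]

TWO-LAYER PLAN. First split to file (tenure): ExplorationHitCardy ⇐ DoobIdentity → ObliqueInvariance
→ TipBalance → ExplorationHitCardy (k = 3; glue = filter
algebra, certified in Sketch3.lean: hit − u₀ − tipBalanceSum/2 → 0, u₀ → F(η), tipBalanceSum → 0).
Later, if TipBalance moves: TipBalance ⇐
TipStencilDecay (|E[(c_n − 2u_n)(f_n) | tip environment]| ≲ (depth of tip)^{1/3+α}) → WeightBudget
(E Σ_n w_n(c_δ)·depth_n^{-1/3-α} → 0) →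
TipBalance; and ObliqueInvariance ⇐ smooth domains (Kang–Williams scheme) → Jordan domains by
monotone approximation → ObliqueInvariance.

KILL CRITERIA. ¬ExplorationHitCardy together with CrossingHitDictionary and DiscretisationExists is
¬CardyFormulaZ2: closes every Cardy route, report to
operator. ¬CrossingHitDictionary (crossing and lattice hitting events differ macroscopically for
some admissible family) kills only this
frame: restate X over the thickened open events CurveClass.hitsBeforeApprox shared with the
CardyViaSLE6 repair items (8608/8638).
¬DiscretisationExists for some Jordan domain: restrict the frame to domains with rectifiable
boundary plus a RectilinearSuffices-type
approximation support (CardyViaSLE6 template). ¬KernelDominance for the filed kernel: redesign the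
redirection kernel once (resplit); a
second failure closes the OHE companion but not the identity. ¬ObliqueInvariance for every
slope-blind local kernel: restate with an
Ω-adapted boundary kernel; if no local kernel converges to ORBM(π/3) in Jordan domains the line is
dead — close refuted:ObliqueInvariance.
TipBalance shown to have non-decaying per-step bias |E s_n| ≍ w_n (pure oscillation, the
kakutani-fingerprint verdict transplanted): close
refuted:TipBalance. SLE6LimitZ2AllDiscretisations or CardyFormulaZ2 proved elsewhere moots the
route.

NOT DECOMPOSED YET. The kernel itself (which redirect target r(f), how the b-corner absorbs, medial
cells vs faces) — fixed by the definition seat with the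
KernelDominance grounder; the interior of TipBalance (tip-environment symmetry, singular-mode
expansion at a slit tip, weight budget Σ_n
w_n(c_δ)); the interior of ObliqueInvariance (smooth vs Jordan boundary, comparison principle for
the mixed oblique problem); the interior
of CrossingHitDictionary (RSW / half-plane arm estimates near the marks, measurability of the
lattice events); the OHE → SLE₆ companion is
NOT filed.

CHEAPEST FALSIFIER. The hexagonal control, by simulation before any Lean: on site-𝕋 (where Smirnov's
theorem forces it) and on bond-ℤ², run 10⁴ explorations in
an equilateral / square domain of 60–120 cells, one sparse linear solve per step, and record S = Σ_n
w_n(c)(c_n − 2u_n)(f_n): (i) does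
u₀^δ(c) approach F(η) (tests the kernel = ObliqueInvariance; a 45°-rotated square vs an
axis-parallel one isolates the slope effect); (ii) is
mean(S) → 0 with δ on 𝕋 (it must) and on ℤ²; (iii) does |E s_n| decay with the tip's distance to ∂Ω
or only oscillate? An O(1) plateau of
E S on ℤ² with (i) passing refutes TipBalance numerically; c_n < u_n(f_n) at any step refutes
KernelDominance for that kernel outright. Not
run here (compute-free hub; kit job for the refuter/grounder once D1 fixes the kernel).

NUMBERS. F(1/2) = 1/2 (square, by duality — value-free check of the kernel); F(η) = 3Γ(2/3)/Γ(1/3)²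
η^{1/3} ₂F₁(1/3,2/3;4/3;η); reflection angle π/3
from the tangent (π/6 off the inward normal) toward b on (ab) ∪ (bd), i.e. redirection odds tan(π/6)
= 1/√3 of tangential drift per unit
boundary local time on a flat lattice row; exploration length ≍ δ^{-7/4} steps; boundary/tip
singular exponent of the mixed
Dirichlet–oblique problem at a slit tip: 1/3. Items after repair: 9 (cruxes TipBalance 2,
ObliqueInvariance 3, ExplorationHitCardy 4, CrossingHitDictionary 5, KernelDominance 6; supports
DoobIdentity, CarlesonAtOpenCorner, DiscretisationExists; Assembly).

DEFINITION REQUESTS. D1 obliqueMedialAbsorb (topic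
Summits/CriticalPhenomena/CardyFormulaZ2/Theorems): for Dobrushin data E δ of a discretising family,
mesh δ
and a finite set of revealed medial cells with types, the Markov chain on unrevealed medial vertices
(primal edges) of Ω_δ — SRW on the
medial graph inside; attempted steps into KILLING cells (cells of the dual-wired arc,
revealed-closed cells, cells leaving Ω_δ) go to a
cemetery; attempted steps into REFLECTING cells (cells of the wired arc up to c, of (cd), and
revealed-open cells) are redirected to r(f),
the reflecting-or-interior neighbour of f nearer to b along the boundary/bank; ABSORBING set = cells
within 2δ of b = R.pt 1 — outputs
u(z), w_f(z), c(f) = (u(r f) − u(f)·w_f(r f)) / (1 − w_f(r f)). D2 tipBalanceSum R E δ := E_{1/2}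
Σ_{n<T} w_{f_n}(c_δ)·(c(f_n) − 2u(f_n)) along
medialExploration (E δ), T = first step adjacent to (bc)_δ ∪ (cd)_δ, c_δ = the (cd)_δ-cell nearest
R.pt 2. Both LANDED (defn-obliqueMedialAbsorb,
defn-tipBalanceSum done) with the datum D = E δ as argument, exactly as the typed frame needs; no
further definition is requested.

Novelty: Searches (2026-08-15): `lit search --hybrid "harmonic explorer SLE convergence oblique reflection"`
(12 rows: Lawler2005 book pp. 31, 242,
Rohde arXiv:1007.2007 p. 34; rest noise); `lit search --source zbmath "harmonic explorer"` (15: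
SchrammSheffield2005, Kojar arXiv:2206.13709
left-passage explorer, Celani–Mazzino–Tizzi 2009 doi:10.1088/1742-5468/2009/12/p12011 overruled
explorers, Papon arXiv:2307.11509 massive HE,
Lan–Ma–Zhou arXiv:2003.01949, Karrila arXiv:2208.06008); `lit search --source zbmath "Brownian
motion in a wedge with oblique reflection"`
(12: VaradhanWilliams1985, Williams 1985 ×2, Franceschi–Raschel 1703.09433); `lit search --source
zbmath "invariance principle semimartingale
reflecting Brownian motions piecewise smooth"` (2: KangWilliams2007 = arXiv:0704.0405); `lit search
--source zbmath "reflected Brownian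
motion crossing probabilities intertwining"` (1: Dubedat2004); `lit read arxiv:2206.13709` pp. 2–5
(coin from a RW×Bessel hitting
probability solving Schramm's left-passage PDE on the square lattice; author notes no conformal
invariance for κ ≠ 4); OpenAlex/S2/arXiv
APIs 429 and galaxy queue saturated this session — the card's own galaxy sweeps ('harmonic explorer'
23 rows; bm25 pdf on reflected/oblique
HE variants 25 rows) stand. Nearest prior art found: SchrammSheffield2005 (Dirichlet harmonic coin,
Doob factorisation, SLE₄);
arXiv:2206.13709 (non-harmonic bulk coin for other κ, no oblique boundary, no Cardy observable);
Dubedat2004 + LawlerSchrammWer  [refs: 10.1088/1742-5468/2009/12/p12011, 1007.2007, 2206.13709, 2307.11509, 2003.01949, 2208.06008, 0704.0405, 1112.2017, doi:10.1088/1742-5468/2009/12/p12011, arxiv:2206.13709, Lawler2005, SchrammSheffield2005, VaradhanWilliams1985, KangWilliams2007, Dubedat2004, LawlerSchrammWerner2001, Werner2007]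

Barriers (technique_class: oblique-harmonic-explorer, doob-factorisation, tip-balance): - technique_class: oblique-harmonic-explorer, doob-factorisation, tip-balance
- Literature.Barriers.CriticalPhenomena.SmirnovTriangularOnly: not in class — no separation
probabilities H_α, no colour switching, no discrete contour integral of a percolation observable;
the 2π/3 geometry enters only through the reflection direction of an auxiliary walk, which exists on
any planar graph.
- Literature.Barriers.CriticalPhenomena.FKParafermionicHalfCauchyRiemann: not in class — the
discrete boundary-value problem solved here is that of a Markov chain (fully determined, elliptic,
both "halves" automatic), not a half-determined vertex relation for an edge observable of
percolation.
- Literature.Barriers.CriticalPhenomena.EmbeddingModulusUniqueness: evaded honestly — the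
redirection rule uses the Euclidean angles of the square embedding (π/3 toward b), so for a sheared
embedding the same recipe defines a different walk with a different limit; TipBalance is
embedding-specific, as any proof of Cardy on ℤ² must be.
- Literature.Barriers.CriticalPhenomena.CoveringLatticeShift: not in class — no model interpolation,
no Russo derivative in q, no covering-lattice shift; the only interpolation in view (fair coin ↔
oblique coin, p_n^{(λ)}) is between processes on the same lattice and is not load-bearing.
- Literature.Barriers.CriticalPhenomena.BootstrapLatticeBlindness: not in class — no
positivity/bootstrap certificate; the probe sees the lattice through the explicit kernel.
- Negatives index:

Novelty grade: new-combination — REVIEW rreview-7b9376c7 2026-08-15. VERDICT: HOLD — typed layer unsound as filed, mechanism layer informal Not a recombination of closed routes; negatives: none. (1) Route file never generated (rev 0, commit -; Theses/CardyObliqueExplorer.lean absent): no citable decl. Planner's v2 notes (12:13Z/12: (refuter refuter-rreview-route-AtomisticToContinu-7b9376c7-0, 2026-08-15T13:47:56Z; prior: SchrammSheffield2005 math/0310210; Dubedat2004 math/0302250; LawlerSchrammWerner2001; Werner2007; arXiv:2206.13709; Literature/Probability/Percolation/CanonicalDiscretisationTies.lean)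

History (route lifecycle, newest last):
- 2026-08-15T16:50:41Z · rev 1: restated Assembly (stmt-CriticalPhenomena-6207) — route-repair (glue.missing; rbadge g2): typed frame re-based per refuter review rreview-7b9376c7 and the v2/v3 planner intent — ADD crux ExplorationHitCardy (X (planner-rbadge-CriticalPhenomena-CardyObliqueE-35a5e97f-g2-0)
- 2026-08-15T16:50:41Z · rev 1: dropped ExplorationCardy, InterfaceDictionary, AdmissibleSuffices — route-repair (glue.missing; rbadge g2): typed frame re-based per refuter review rreview-7b9376c7 and the v2/v3 planner intent — ADD crux ExplorationHitCardy (X (planner-rbadge-CriticalPhenomena-CardyObliqueE-35a5e97f-g2-0)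
- 2026-08-15T16:54:27Z · rev 1: dropped ExplorationCardy, InterfaceDictionary, AdmissibleSuffices — route-repair (glue.missing; rbadge g2), second half of the 16:50:41Z edit that the gate half-applied under farm-unavailable (Assembly 6207 retired, thesis/impor (planner-rbadge-CriticalPhenomena-CardyObliqueE-35a5e97f-g2-0)
- 2026-08-15T17:24:16Z · rev 3: dropped ExplorationCardy, InterfaceDictionary, AdmissibleSuffices — cone repair (route-repair, repair_kind=cone; planner-rrepair-CriticalPhenomena-CardyOblique-35a5e97f-0): DROP the import Literature.Probability.Percolation.Inte (planner-rrepair-CriticalPhenomena-CardyOblique-35a5e97f-0)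
- 2026-08-16T03:16:34Z · rev 9: dropped ExplorationHitGlue — re-rank only (route-choice repair, option a): drop the rank-9 want of the glue item ExplorationHitGlue (stmt-CriticalPhenomena-14134) because same-rank items re (planner-rchoice-CriticalPhenomena-CardyOblique-58a3319d-0)
- 2026-08-16T03:28:22Z · rev 10: dropped stmt-CriticalPhenomena-14134 — re-rank only (route-choice repair, option a): drop the rank-9 want of glue item stmt-CriticalPhenomena-14134 (ExplorationHitGlue) — at rank 9 it renders (id ord (planner-rchoice-CriticalPhenomena-CardyOblique-58a3319d-0)
- 2026-08-16T03:50:11Z · AUTO-CRUX (backfill): ExplorationHitCardy — hypotheses of the deciding theorem that nothing in the route derives are cruxes (operator:999:586464)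
- 2026-08-24T00:04:13Z · DORMANT — reconciler: no traction for 6.4 d (last activity item-evidence-added at 2026-08-17T14:50:25Z); parked, not closed — `ledger route dormant route-CriticalPhenomen (operator:999:567339)

sub-problem: CardyFormulaZ2 · status: dormant · opened planner-plancard-CriticalPhenomena-CardyFormu-44cee51d-0 2026-08-15T11:45:03Z · rev 11 · ledger route-CriticalPhenomena-CardyObliqueExplorer
GENERATED by the gate from the ledger (D-0016/17). Provers cite these decls: `theorem foo : Summit.CriticalPhenomena.CardyFormulaZ2.Theses.CardyObliqueExplorer.<Decl> := …` in Summits/CriticalPhenomena/CardyFormulaZ2/Theorems/<Name>.lean.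
-/

namespace Summit.CriticalPhenomena.CardyFormulaZ2.Theses.CardyObliqueExplorer

open scoped BigOperators Topology Manifold Classical MeasureTheory ProbabilityTheory Matrix InnerProductSpace ComplexConjugate ContinuousMap
open Filter Set Function TopologicalSpace MeasureTheory

attribute [summit_statement] _root_.CardyFormulaZ2

/-- item stmt-CriticalPhenomena-7451 · crux · rank 2 · open · by planner
why it might fail: By DoobIdentity tipBalanceSum → 2·(lim P[hit] − lim u₀): FALSE wherever the slope-blind kernel's u₀ misses F(η) (ObliqueInvariance's printed failure mode off axis-parallel sides) even if Cardy holds; else equivalent to X, dying if the tip stencil (c_n − 2u_n)(f_n) keeps a non-decaying per-step bias.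
sources: SchrammSheffield2005, Dubedat2004, Kager2007, arXiv:1112.2017, GarbanPeteSchramm2013, Smirnov2001
[crux] TipBalance (card oblique-harmonic-explorer-2, Crux 2; the hardest / most informative item).
For every conformal rectangle R = (Ω; a, b, c, d) whose chord-(a,c) Dobrushin discretisation is
eventually admissible, along the medial exploration γ^δ of critical bond percolation on δℤ² from a
(arc (ab) open, arc (da) closed), stopped at T = the first step adjacent to (bc) ∪ (cd):
tipBalanceSum R δ := E_{1/2}[ Σ_{n<T} w_n(c_δ) · (c_n(f_n) − 2 u_n(f_n)) ] → 0 as δ → 0⁺. Here f_n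
is the medial cell (primal edge) revealed at step n; u_n, w_n, c_n are the outputs of the requested
definition obliqueMedialAbsorb in the slit domain after n steps (walk on unrevealed medial cells:
SRW inside; killed on (da)-cells, revealed-closed cells and outside Ω_δ; redirected toward b on
(ab), (bc), (cd)-cells and revealed-open cells; absorbed within 2δ of b): u_n(z) = P_z[absorbed at
b], w_n(z) = P_z[attempted entry into f_n], c_n(f_n) = value of an attempted entry into f_n once f_n
reflects. By DoobIdentity, TipBalance ∧ ObliqueInvariance ⇒ ExplorationCardy. WHY IT MIGHT FAIL:
given ObliqueInvariance and DoobIdentity it is EQUIVALENT to ExplorationCardy (no free lunch); as a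
handle it fails if |c_n − 2 -/
@[route_item "route-CriticalPhenomena-CardyObliqueExplorer"]
def TipBalance : Prop :=
  ∀ (R : Literature.Probability.RandomPlanarGeometry.ConformalRectangle) (E : ℝ → Literature.Probability.LatticeModels.DiscreteDobrushin), (∀ δ, (E δ).Ω = R.carrier ∧ (E δ).δ = δ) → Filter.Tendsto (fun δ => Metric.hausdorffEDist (E δ).arcA ((R.chord 0 2 (by decide)).arc 0)) (nhdsWithin 0 (Set.Ioi 0)) (nhds 0) → Filter.Tendsto (fun δ => Metric.hausdorffEDist (E δ).arcB ((R.chord 0 2 (by decide)).arc 1)) (nhdsWithin 0 (Set.Ioi 0)) (nhds 0) → Filter.Tendsto (fun δ => Metric.hausdorffEDist (Literature.Probability.LatticeModels.medialPoint δ '' (E δ).zdABEdges) {R.pt 0, R.pt 2}) (nhdsWithin 0 (Set.Ioi 0)) (nhds 0) → (∀ᶠ δ in nhdsWithin (0:ℝ) (Set.Ioi 0), (E δ).IsZdAdmissible) → Filter.Tendsto (fun δ => Literature.Probability.Percolation.tipBalanceSum R (E δ)) (nhdsWithin 0 (Set.Ioi 0)) (nhds 0)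

/-- item stmt-CriticalPhenomena-7456 · crux · rank 3 · open · by planner
why it might fail: Print (Dubedat2004 §2 L.1; Kager2007 §2): with a homogeneous boundary kernel the limit reflects along the MEAN boundary step. The slope-blind D1 rule has slope-dependent mean push (π/2 on diagonal staircases, D1 doc) ⇒ wrong mixed problem, u₀^δ(c_δ) ↛ F(η) off rectilinear carriers: likely false ∀ R.
sources: Dubedat2004, Kager2007, VaradhanWilliams1985, KangWilliams2007, LawlerSchrammWerner2001, Smirnov2001
[crux] ObliqueInvariance (card Crux 1; a stand-alone theorem-sized statement, independent of
percolation). For every conformal rectangle R = (Ω; a, b, c, d) and every uniformizing datum (η its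
cross-ratio), the absorption probability of the oblique medial walk in the FIXED discrete domain Ω_δ
(no slit; same kernel family as in TipBalance: SRW on medial cells inside, killed on (da)-cells and
outside, redirected toward b on (ab) ∪ (bc) ∪ (cd)-cells, absorbed within 2δ of b), started from the
target-arc cell c_δ nearest c = R.pt 2, converges: u₀^δ(c_δ) → cardyFunction(η) as δ → 0⁺. Content:
an invariance principle 'obliquely redirected/killed random walk → Brownian motion obliquely
reflected at angle π/3 (from the tangent, toward b) on (ab) ∪ (bd), killed on (da)' in a Jordan
domain, plus the identification of the ORBM absorption probability at the corner b with the height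
coordinate in the equilateral chart of the conformal triangle (a; b, d) (gambler's ruin), whose
value at c is |c − d|/|b − d| = F(η) by CarlesonAtOpenCorner. WHY IT MIGHT FAIL: a slope-blind local
redirection rule on a lattice staircase has an effective reflection angle that depends on the
boundary slope relative to -/
@[route_item "route-CriticalPhenomena-CardyObliqueExplorer"]
def ObliqueInvariance : Prop :=
  ∀ (R : Literature.Probability.RandomPlanarGeometry.ConformalRectangle) (E : ℝ → Literature.Probability.LatticeModels.DiscreteDobrushin), (∀ δ, (E δ).Ω = R.carrier ∧ (E δ).δ = δ) → Filter.Tendsto (fun δ => Metric.hausdorffEDist (E δ).arcA ((R.chord 0 2 (by decide)).arc 0)) (nhdsWithin 0 (Set.Ioi 0)) (nhds 0) → Filter.Tendsto (fun δ => Metric.hausdorffEDist (E δ).arcB ((R.chord 0 2 (by decide)).arc 1)) (nhdsWithin 0 (Set.Ioi 0)) (nhds 0) → Filter.Tendsto (fun δ => Metric.hausdorffEDist (Literature.Probability.LatticeModels.medialPoint δ '' (E δ).zdABEdges) {R.pt 0, R.pt 2}) (nhdsWithin 0 (Set.Ioi 0)) (nhds 0) → (∀ᶠ δ in nhdsWithin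 (0:ℝ) (Set.Ioi 0), (E δ).IsZdAdmissible) → R.HasCrossingLimit (fun δ => Literature.Probability.LatticeModels.obliqueMedialAbsorb R (E δ) ∅ [] (Literature.Probability.LatticeModels.obliqueMedialCCell R (E δ))) Literature.Probability.RandomPlanarGeometry.cardyFunction

/-- item stmt-CriticalPhenomena-11249 · crux (kind.auto-crux: conjecture-grade) · rank 4 · open · by planner
why it might fail: = CardyFormulaZ2 mod CrossingHitDictionary + DiscretisationExists (refuter crux-attack 17:10Z: survives, not vacuous, RESTATES-TARGET): false iff Cardy fails for bond-ℤ² (Zhang arXiv:2206.04599 Cor 2 vs Zhou arXiv:2409.03235 Cor 1.1, both unrefereed); closes only via the layer-2 glue or SLE₆ on ℤ².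
sources: Smirnov2001, Werner2007, Schramm2007ICM, arXiv:2206.04599, arXiv:2409.03235, CamiaNewman2007
[crux] X itself, typed (the node that TipBalance (2), ObliqueInvariance (3), KernelDominance (6) and
DoobIdentity decompose once D1/D2 land): for every conformal rectangle R and every admissible
discretising family E of its chord (Ω; a, c) (fields of ZdDiscretisationFamily / IsDiscretisation
inlined: (E δ).Ω = Ω, mesh δ, arcs → (abc), (cda) in Hausdorff distance, discrete marks → {a, c},
IsZdAdmissible eventually), the P_{1/2}-probability that the a→c-oriented medial exploration of E δ
examines an edge with an endpoint on zdDiscreteArc (R.arc 2) = (cd)_δ before any edge with an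
endpoint on zdDiscreteArc (R.arc 1) = (bc)_δ has crossing limit cardyFunction (→ F(η) for every
uniformizing datum). Same event, verbatim, as in CrossingHitDictionary; replaces ExplorationCardy
(6205). [deps: CrossingHitDictionary, DiscretisationExists] [difficulty: open-problem] -/
@[route_item "route-CriticalPhenomena-CardyObliqueExplorer", crux]
def ExplorationHitCardy : Prop :=
  ∀ (R : Literature.Probability.RandomPlanarGeometry.ConformalRectangle) (E : ℝ → Literature.Probability.LatticeModels.DiscreteDobrushin), (∀ δ, (E δ).Ω = R.carrier ∧ (E δ).δ = δ) → Filter.Tendsto (fun δ => Metric.hausdorffEDist (E δ).arcA ((R.chord 0 2 (by decide)).arc 0)) (nhdsWithin 0 (Set.Ioi 0)) (nhds 0) → Filter.Tendsto (fun δ => Metric.hausdorffEDist (E δ).arcB ((R.chord 0 2 (by decide)).arc 1)) (nhdsWithin 0 (Set.Ioi 0)) (nhds 0) → Filter.Tendsto (fun δ => Metric.hausdorffEDist (Literature.Probability.LatticeModels.medialPoint δ '' (E δ).zdABEdges) {R.pt 0, R.pt 2}) (nhdsWithin 0 (Set.Ioi 0)) (nhds 0) → (∀ᶠ δ in nhdsWithin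 (0:ℝ) (Set.Ioi 0), (E δ).IsZdAdmissible) → R.HasCrossingLimit (fun δ => (Literature.Probability.Percolation.bondPercolation (Literature.Probability.LatticeModels.zdGraph 2) Literature.Probability.Percolation.half).real {cfg | let l := Literature.Probability.LatticeModels.medialExploration (E δ) cfg; let l' := (if (∀ e₀ ∈ l.head?, dist (Literature.Probability.LatticeModels.medialPoint δ e₀) (R.pt 0) ≤ dist (Literature.Probability.LatticeModels.medialPoint δ e₀) (R.pt 2)) then l else l.reverse); ∃ n : ℕ, ∃ e ∈ l'[n]?, (∃ v ∈ e, v ∈ (E δ).zdDiscreteArc (R.arc 2)) ∧ ∀ m < n, ∀ e' ∈ l'[m]?, ∀ v ∈ e', v ∉ (E δ).zdDiscreteArc (R.arc 1)}) Literature.Probability.RandomPlanarGeometry.cardyFunction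

/-- item stmt-CriticalPhenomena-7364 · crux · rank 5 · open · by planner
why it might fail: Limit-free ∀ Jordan carriers, ∀ admissible E: the boundary-layer gap (touch zdDiscreteArc(cd) vs open path INTO the smaller discreteArc(cd); perturbed marks) needs close-approach-without-touching control on non-convex fractal arcs, where the 3-arm argument breaks down (CamiaNewman2007 Rem 7.1).
sources: CamiaNewman2007, Werner2007, Nolin2008, Smirnov2001, Grimmett1999, Literature.Probability.Percolation.LawlerSchrammWerner2002_halfPlane_threeArm
[crux] CrossingHitDictionary — crossing / discrete-hitting dictionary on ℤ²: for every conformal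
rectangle R = (Ω; a, b, c, d) and every admissible discretising family E of its chord (Ω; a, c) (the
fields of LatticeModels.IsDiscretisation, inlined: (E δ).Ω = Ω, mesh δ, wired arc → (abc) and
dual-wired arc → (cda) in Hausdorff distance, discrete marks → {a, c}, IsZdAdmissible for small δ),
the free-boundary crossing probability P_{1/2}[(ab)_δ ↔ (cd)_δ in Ω_δ] (G02 discreteCrossing =
bondDomainCrossingProb R δ) and the probability that the a→c-oriented medial exploration of E δ
examines an edge with an endpoint on the discrete arc zdDiscreteArc (R.arc 2) of (cd) before any
edge with an endpoint on the discrete arc of (bc) differ by o(1) as δ → 0⁺. On the lattice the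
hitting event is 'an open path from the wired arc to a (cd)-boundary edge is found before a dual
path from the right bank reaches (bc)'; the o(1) is boundary-condition insensitivity near the four
marks (wired vs free (ab), E's perturbed arcs vs R's discrete arcs, largest-component conventions).
Replaces on this route the shared CardyViaSLE6.InterfaceDictionary (stmt-CriticalPhenomena-0754),
whose continuum event CurveClas -/
@[route_item "route-CriticalPhenomena-CardyObliqueExplorer", crux]
def CrossingHitDictionary : Prop :=
  ∀ (R : Literature.Probability.RandomPlanarGeometry.ConformalRectangle) (E : ℝ → Literature.Probability.LatticeModels.DiscreteDobrushin), (∀ δ, (E δ).Ω = R.carrier ∧ (E δ).δ = δ) → Filter.Tendsto (fun δ => Metric.hausdorffEDist (E δ).arcA ((R.chord 0 2 (by decide)).arc 0)) (nhdsWithin 0 (Set.Ioi 0)) (nhds 0) → Filter.Tendsto (fun δ => Metric.hausdorffEDist (E δ).arcB ((R.chord 0 2 (by decide)).arc 1)) (nhdsWithin 0 (Set.Ioi 0)) (nhds 0) → Filter.Tendsto (fun δ => Metric.hausdorffEDist (Literature.Probability.LatticeModels.medialPoint δ '' (E δ).zdABEdges) {R.pt 0, R.pt 2}) (nhdsWithin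 0 (Set.Ioi 0)) (nhds 0) → (∀ᶠ δ in nhdsWithin (0:ℝ) (Set.Ioi 0), (E δ).IsZdAdmissible) → Filter.Tendsto (fun δ => Literature.Probability.Percolation.bondDomainCrossingProb R δ - (Literature.Probability.Percolation.bondPercolation (Literature.Probability.LatticeModels.zdGraph 2) Literature.Probability.Percolation.half).real {cfg | let l := Literature.Probability.LatticeModels.medialExploration (E δ) cfg; let l' := (if (∀ e₀ ∈ l.head?, dist (Literature.Probability.LatticeModels.medialPoint δ e₀) (R.pt 0) ≤ dist (Literature.Probability.LatticeModels.medialPoint δ e₀) (R.pt 2)) then l else l.reverse); ∃ n : ℕ, ∃ e ∈ l'[n]?, (∃ v ∈ e, v ∈ (E δ).zdDiscreteArc (R.arc 2)) ∧ ∀ m < n, ∀ e' ∈ l'[m]?, ∀ v ∈ e', v ∉ (E δ).zdDiscreteArc (R.arc 1)}) (nhdsWithin 0 (Set.Ioi 0)) (nhds 0)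

/-- item stmt-CriticalPhenomena-7448 · crux · rank 6 · open · by planner
why it might fail: ∀ ω₀ and fresh steps, for the FILED slope-blind kernel: ū(pathRedirect) ≥ u(f) is no maximum-principle consequence — in a fjord both redirect targets (mirror of the predecessor, outward translate) can be revealed-closed/killing (value 0) while u(f) > 0 ⇒ c_n < u_n; one reachable geometry refutes it.
sources: SchrammSheffield2005, Dubedat2004, Literature.Probability.LatticeModels.ObliqueMedial.absorbProb_le_of_bellman_le
[crux] KernelDominance (card S1 — 'first thing a grounder should settle'). For the filed kernel of
obliqueMedialAbsorb, in every slit domain reachable by the medial exploration (any admissible R, any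
δ, any n < T) and for the fresh cell f_n about to be revealed: c_n(f_n) ≥ u_n(f_n), equivalently
u_n(r(f_n)) ≥ u_n(f_n) where r(f) is the redirect target of f (since c = (u(r) − u(f)·w_f(r)) / (1 −
w_f(r))). Consequences: the oblique coin p_n = u_n(f_n)/c_n(f_n) lies in [0,1], so the OBLIQUE
HARMONIC EXPLORER (declare f_n open with probability p_n) is a well-defined process with u_n(z) an
exact martingale for every z simultaneously (the companion → SLE₆ statement, not load-bearing), and
the stencil c_n − 2u_n in TipBalance has the sign structure the tip-symmetry argument presumes. A
discrete maximum-principle / monotonicity statement for the mixed killed/redirected chain. WHY IT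
MIGHT FAIL: redirecting the mass of f toward b can LOWER the absorption probability when the
redirect target r(f) sits closer to the killing bank than f's average neighbour — tip geometries
where the open (left) bank doubles back on itself; then p_n > 1 locally and the kernel must be
redesigned (several discret -/
@[route_item "route-CriticalPhenomena-CardyObliqueExplorer"]
def KernelDominance : Prop :=
  ∀ (R : Literature.Probability.RandomPlanarGeometry.ConformalRectangle) (E : ℝ → Literature.Probability.LatticeModels.DiscreteDobrushin), (∀ δ, (E δ).Ω = R.carrier ∧ (E δ).δ = δ) → Filter.Tendsto (fun δ => Metric.hausdorffEDist (E δ).arcA ((R.chord 0 2 (by decide)).arc 0)) (nhdsWithin 0 (Set.Ioi 0)) (nhds 0) → Filter.Tendsto (fun δ => Metric.hausdorffEDist (E δ).arcB ((R.chord 0 2 (by decide)).arc 1)) (nhdsWithin 0 (Set.Ioi 0)) (nhds 0) → Filter.Tendsto (fun δ => Metric.hausdorffEDist (Literature.Probability.LatticeModels.medialPoint δ '' (E δ).zdABEdges) {R.pt 0, R.pt 2}) (nhdsWithin 0 (Set.Ioi 0)) (nhds 0) → (∀ᶠ δ in nhdsWithin (0:ℝ) (Set.Ioi 0), (E δ).IsZdAdmissible)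 → ∀ᶠ δ in nhdsWithin (0:ℝ) (Set.Ioi 0), ∀ ω₀ : Literature.Probability.Percolation.BondConfig (Literature.Probability.LatticeModels.Site 2), ∀ n < Literature.Probability.Percolation.tipBalanceStop R (E δ) ω₀, 0 < n → ∀ f ∈ (Literature.Probability.Percolation.acMedialExploration R (E δ) ω₀)[n]?, ∀ p ∈ (Literature.Probability.Percolation.acMedialExploration R (E δ) ω₀)[n - 1]?, f ∉ (Literature.Probability.Percolation.acMedialExploration R (E δ) ω₀).take n → ¬ Literature.Probability.LatticeModels.ObliqueMedial.NearB R (E δ) f → Literature.Probability.LatticeModels.obliqueMedialAbsorb R (E δ) ((E δ).bcBondConfig ω₀) ((Literature.Probability.Percolation.acMedialExploration R (E δ) ω₀).take n) f ≤ ((Literature.Probability.LatticeModels.ObliqueMedial.pathRedirect Literature.Probability.LatticeModels.ObliqueMedial.obliqueWeight p f).map fun tp => tp.2 * Literature.Probability.LatticeModels.obliqueMedialAbsorb R (E δ) ((E δ).bcBondConfig ω₀) ((Literature.Probability.Percolation.acMedialExploration R (E δ) ω₀).take n) tp.1).sum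

/-- item stmt-CriticalPhenomena-6206 · support · rank 9 · open · by planner
sources: Werner2007, Smirnov2001, BollobasRiordan2006
[support] Carleson's identity at the corner where the oblique observable lives: if R = (Ω; a, b, c,
d) has carrier the open equilateral triangle on a, b, d and its third mark c lies on the open side
(b, d), then for every uniformizing datum cardyFunction(η) = |c − d| / |b − d|. Provable now from
the PROVED fact cardyFunction_crossRatio_eq_of_equilateral_holds applied to the rotated marking (d,
a, b, c) (a Möbius pre-composition makes the preimages monotone), η ↦ 1 − η under the rotation, and
F(1 − η) = 1 − F(η). [difficulty: provable-now] -/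
@[route_item "route-CriticalPhenomena-CardyObliqueExplorer"]
def CarlesonAtOpenCorner : Prop :=
  ∀ (R : Literature.Probability.RandomPlanarGeometry.ConformalRectangle) (a b c d : ℂ), (dist a b = dist b d ∧ dist b d = dist d a ∧ a ≠ b) → R.carrier = interior (convexHull ℝ {a, b, d}) → (R.pt 0 = a ∧ R.pt 1 = b ∧ R.pt 2 = c ∧ R.pt 3 = d) → c ∈ segment ℝ b d → c ≠ b → c ≠ d → ∀ (g : Literature.Probability.RandomPlanarGeometry.ConformalEquiv UpperHalfPlane.upperHalfPlaneSet R.carrier) (x : Fin 4 → ℝ), R.IsUniformizing g x → Literature.Probability.RandomPlanarGeometry.cardyFunction (Literature.Probability.RandomPlanarGeometry.crossRatio x) = ‖c - d‖ / ‖b - d‖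

/-- item stmt-CriticalPhenomena-7379 · support · rank 9 · open · by planner
[support] DiscretisationExists — non-vacuity of the route's typed frame: every chord (Ω; a, c) of a
conformal rectangle R admits an admissible square-lattice discretising family E : ℝ →
DiscreteDobrushin (exactly the fields of Literature.Probability.LatticeModels.IsDiscretisation
(R.chord 0 2) E, inlined because InterfaceSLE is not among the route's imports: canonical domain (E
δ).Ω = Ω, mesh δ, wired arc (E δ).arcA → (abc) and dual-wired arc (E δ).arcB → (cda) in Hausdorff
distance, discrete marked points (midpoints of the two A–B edges) → {a, c}, IsZdAdmissible for all
small δ). Expected witness (module doc of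
Literature/Probability/Percolation/InterfaceScalingLimitDiscretised.lean, 'Satisfiability of
IsDiscretisation'): rotate / perturb the endpoints of the two arcs by a mesh-dependent amount ≍ δ so
that no site of zdBoundary is equidistant from the two arcs (no tie) and exactly one A–B edge sits
at each mark, each bordering exactly one inner face. Not yet constructed anywhere in the tree for
any domain; also wanted by every user of SLE6LimitZ2AllDiscretisations. A prover with `import
Literature.Probability.LatticeModels.InterfaceSLE` can repackage the conjunction as an IsDiscre -/
@[route_item "route-CriticalPhenomena-CardyObliqueExplorer", crux]
def DiscretisationExists : Prop :=
  ∀ R : Literature.Probability.RandomPlanarGeometry.ConformalRectangle, ∃ E : ℝ → Literature.Probability.LatticeModels.DiscreteDobrushin, (∀ δ, (E δ).Ω = R.carrier ∧ (E δ).δ = δ) ∧ Filter.Tendsto (fun δ => Metric.hausdorffEDist (E δ).arcA ((R.chord 0 2 (by decide)).arc 0)) (nhdsWithin 0 (Set.Ioi 0)) (nhds 0) ∧ Filter.Tendsto (fun δ => Metric.hausdorffEDist (E δ).arcB ((R.chord 0 2 (by decide)).arc 1)) (nhdsWithin 0 (Set.Ioi 0)) (nhds 0) ∧ Filter.Tendsto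 (fun δ => Metric.hausdorffEDist (Literature.Probability.LatticeModels.medialPoint δ '' (E δ).zdABEdges) {R.pt 0, R.pt 2}) (nhdsWithin 0 (Set.Ioi 0)) (nhds 0) ∧ ∀ᶠ δ in nhdsWithin (0:ℝ) (Set.Ioi 0), (E δ).IsZdAdmissible

/-- item stmt-CriticalPhenomena-7457 · support · rank 9 · open · by planner
[support] DoobIdentity (card 'KEY EXACT FACT' + identity (2); provable as soon as definitions D1/D2
land — finite Markov-chain algebra + optional stopping for a bounded martingale over ≤ #cells
steps). For admissible R and every δ > 0: P_{1/2}[the medial exploration interface of (Ω; a, c) hits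
(cd) before (bc)] − u₀^δ(c_δ) = ½ · tipBalanceSum R δ. Ingredients: (i) rank-one updates when the
fresh cell f is revealed — u^{f closed} − u = −u(f)·w_f and u^{f open} − u = (c(f) − u(f))·w_f as
functions of the starting cell (strong Markov property at the first attempted entry into f; the
redirect target r(f) is a single cell, which is what makes the open update rank-one; c(f) solves c =
u(r f) + (c − u(f))·w_f(r f)); (ii) the coin at a fresh cell is fair and independent of the past,
forced steps (revisited cells) contribute 0; (iii) at the stopping step T the observable is decided:
on {hit (cd) first} the component of unrevealed cells containing c_δ is bounded by reflecting cells
only and contains the absorbing corner, so u_T(c_δ) = 1 (absorption a.s. — part of the kernel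
design), on {hit (bc) first} the corner b is cut off by the killing right bank, so u_T(c_δ) = 0.
Hence P[success] = E u -/
@[route_item "route-CriticalPhenomena-CardyObliqueExplorer"]
def DoobIdentity : Prop :=
  ∀ (R : Literature.Probability.RandomPlanarGeometry.ConformalRectangle) (E : ℝ → Literature.Probability.LatticeModels.DiscreteDobrushin), (∀ δ, (E δ).Ω = R.carrier ∧ (E δ).δ = δ) → Filter.Tendsto (fun δ => Metric.hausdorffEDist (E δ).arcA ((R.chord 0 2 (by decide)).arc 0)) (nhdsWithin 0 (Set.Ioi 0)) (nhds 0) → Filter.Tendsto (fun δ => Metric.hausdorffEDist (E δ).arcB ((R.chord 0 2 (by decide)).arc 1)) (nhdsWithin 0 (Set.Ioi 0)) (nhds 0) → Filter.Tendsto (fun δ => Metric.hausdorffEDist (Literature.Probability.LatticeModels.medialPoint δ '' (E δ).zdABEdges) {R.pt 0, R.pt 2}) (nhdsWithin 0 (Set.Ioi 0)) (nhds 0) → (∀ᶠ δ in nhdsWithin (0:ℝ) (Set.Ioi 0), (E δ).IsZdAdmissible) → Filter.Tendsto (fun δ => (Literature.Probability.Percolation.bondPercolation (Literature.Probability.LatticeModels.zdGraph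 2) Literature.Probability.Percolation.half).real {cfg | let l := Literature.Probability.LatticeModels.medialExploration (E δ) cfg; let l' := (if (∀ e₀ ∈ l.head?, dist (Literature.Probability.LatticeModels.medialPoint δ e₀) (R.pt 0) ≤ dist (Literature.Probability.LatticeModels.medialPoint δ e₀) (R.pt 2)) then l else l.reverse); ∃ n : ℕ, ∃ e ∈ l'[n]?, (∃ v ∈ e, v ∈ (E δ).zdDiscreteArc (R.arc 2)) ∧ ∀ m < n, ∀ e' ∈ l'[m]?, ∀ v ∈ e', v ∉ (E δ).zdDiscreteArc (R.arc 1)} - Literature.Probability.LatticeModels.obliqueMedialAbsorb R (E δ) ∅ [] (Literature.Probability.LatticeModels.obliqueMedialCCell R (E δ)) - Literature.Probability.Percolation.tipBalanceSum R (E δ) / 2) (nhdsWithin 0 (Set.Ioi 0)) (nhds 0)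

/-- item stmt-CriticalPhenomena-14495 · support · rank 10 · open · by planner
[support] ExplorationHitGlue — the layer-2 glue of the thesis (TWO-LAYER PLAN: X ⇐ DoobIdentity →
ObliqueInvariance → TipBalance → ExplorationHitCardy), filed as an item so the target
ExplorationHitCardy is reachable from the cruxes (route-choice repair of the target-unreachable
hold, 2026-08-16; re-filing of stmt-CriticalPhenomena-14134 at rank 10 instead of 9 ONLY so the gate
renders this decl after the rank-9 support DoobIdentity it names — same-rank items render in id
order). Content: for every conformal rectangle R and admissible discretising family E (the common
hypothesis block of all four decls), DoobIdentity gives P_{1/2}[exploration hits (cd)_δ before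
(bc)_δ] − u₀^δ(c_δ) − tipBalanceSum R (E δ)/2 → 0, ObliqueInvariance gives u₀^δ(c_δ) → F(η) for
every uniformizing datum, TipBalance gives tipBalanceSum R (E δ) → 0; adding the three limits,
P[hit] → F(η), which is ExplorationHitCardy. Pure filter algebra (Tendsto.add, Tendsto.div_const,
Tendsto.congr by ring), no percolation input; PROVED sorry-free in the planner sketch (folder
Sketch.lean, theorem explorationHitGlue_holds, lean check rc 0, 0 sorries) — provable now in ~10
lines by any idle prover. [deps: DoobIdentity, Obl -/
@[route_item "route-CriticalPhenomena-CardyObliqueExplorer"]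
def ExplorationHitGlue : Prop :=
  DoobIdentity → ObliqueInvariance → TipBalance → ExplorationHitCardy

-- earlier Assembly (stmt-CriticalPhenomena-6207, replaced 2026-08-15T16:50:41Z -> stmt-CriticalPhenomena-11127): retired by None — ExplorationCardy → InterfaceDictionary → AdmissibleSuffices → CardyFormulaZ2
/-- item stmt-CriticalPhenomena-11250 · assembly · rank 1 · open · by planner
sources: Smirnov2001, Werner2007
[assembly] DiscretisationExists → ExplorationHitCardy → CrossingHitDictionary → CardyFormulaZ2 —
mirrors the certified deciding theorem `closes` (pick E from DiscretisationExists; Tendsto.add of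
the hit-probability limit and the o(1) dictionary; sub_add_cancel); provable now by the same six
lines. Replaces the rev-0 assembly stmt-CriticalPhenomena-6207 (ExplorationCardy →
InterfaceDictionary → AdmissibleSuffices → CardyFormulaZ2), retired by the half-applied edit of
16:50:41Z. -/
@[route_item "route-CriticalPhenomena-CardyObliqueExplorer"]
def Assembly : Prop :=
  DiscretisationExists → ExplorationHitCardy → CrossingHitDictionary → CardyFormulaZ2

-- records of items no longer active in this route (dropped / restated):
-- earlier InterfaceDictionary (stmt-CriticalPhenomena-0754, dropped 2026-08-15T17:24:16Z): None by None — ∀ R : Literature.Probability.RandomPlanarGeometry.ConformalRectangle, (∀ᶠ δ in nhdsWithin (0:ℝ) (Set.Ioi 0), (Literature.Probability.Percolation.dobrushinData (R.chord 0 2 (by decide)) δ).IsZdAdmissible) → Filter.Tendsto (fun δ => Literature.Probability.Percolation.bondDomainCrossingProb R δ - (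
-- earlier AdmissibleSuffices (stmt-CriticalPhenomena-0756, dropped 2026-08-15T17:24:16Z): None by None — (∀ R : Literature.Probability.RandomPlanarGeometry.ConformalRectangle, (∀ᶠ δ in nhdsWithin (0:ℝ) (Set.Ioi 0), (Literature.Probability.Percolation.dobrushinData (R.chord 0 2 (by decide)) δ).IsZdAdmissible) → R.HasCrossingLimit (Literature.Probability.Percolation.bondDomainCrossingProb R) Literatur
-- earlier ExplorationCardy (stmt-CriticalPhenomena-6205, dropped 2026-08-15T17:24:16Z): None by None — ∀ R : Literature.Probability.RandomPlanarGeometry.ConformalRectangle, (∀ᶠ δ in nhdsWithin (0:ℝ) (Set.Ioi 0), (Literature.Probability.Percolation.dobrushinData (R.chord 0 2 (by decide)) δ).IsZdAdmissible) → R.HasCrossingLimit (fun δ => (Literature.Probability.Percolation.bondPercolation (Literature.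

/-! D-0027 §2.1 — DECIDING THEOREM (planner-authored via `route open/edit --closes-file`; by planner-rrepair-CriticalPhenomena-CardyOblique-35a5e97f-g3-0 2026-08-15T18:30:12Z):
its hypotheses are this route's items and its conclusion the sub-problem Statement (glue_lint), and it elaborates with this file. -/

@[closes "route-CriticalPhenomena-CardyObliqueExplorer"] theorem closes (hD : DiscretisationExists) (hX : ExplorationHitCardy) (hC : CrossingHitDictionary) :
    _root_.CardyFormulaZ2 := by
  intro R φ x hφx
  obtain ⟨E, hE, hA, hB, hM, hadm⟩ := hD R
  -- bondDomainCrossingProb R δ = (crossing − hitting) + hitting → 0 + F(η)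
  have h := (hC R E hE hA hB hM hadm).add (hX R E hE hA hB hM hadm φ x hφx)
  simpa only [sub_add_cancel, zero_add] using h

end Summit.CriticalPhenomena.CardyFormulaZ2.Theses.CardyObliqueExplorer
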